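import Literature.MathematicalPhysics.QuantumFieldTheory.Balaban1983to89.B4Thm110RegionAllF

/-!
# `Balaban1983to89.B4Thm19RegionUnifK` — [Balaban1983RegularityDecay] THEOREM p. 573, INEQUALITY (1.9) (the Hölder
# member) FOR A GENERAL REGION `Ω` UNDER `R₀`, WITH THE BIG-BLOCK SIZE CHOSEN BEFORE `α` (p. 573 «there exist positive
# constants δ₀, c₀, R₀ independent of A, k, Ω and depending on d, M only, c₀ on α also»): close pairs, all pairs, and
# all pairs for an arbitrary `f`

statement-level skeleton of published theorems with citation tags; proofs where landed; nothing here is a claim about the Yang–Mills mass gap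

CITATION HEADER.  T. Bałaban, *Regularity and decay of lattice Green's functions*, Commun. Math. Phys. **89** (1983)
571–597, doi:10.1007/bf01214744 [Balaban1983RegularityDecay] (cell paper B4; held text
`paper:balaban1983-cmp89-regularity-decay`, journal page = PDF page + 570; p. 573).  Unit `lit-balaban-r01` gen 8 (B4
fold owner), HOME `run/shared/lean/pub/lit-balaban/`, SKELETON row **B4.Thm@573** (file 2 of the r01 g8 programme «the
typed Theorem on the general-region-pair family»).  Imports r04 g8 `B4Thm110RegionAllF` (→ r01 g7 `B4Thm19RegionLpAll`,
`B4Thm19RegionLp`, `B4Thm110RegionLpDeriv`, `B4Thm110RegionLp` and the cube-summation engine `cubeSum_bound₂`).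

WHY THIS FILE.  The print fixes the big-block size `M` (p. 572: «Here M is a large positive integer defined later in
this paper.») before the Theorem and says (p. 573, verbatim) «For α < 1 there exist positive constants δ₀, c₀, R₀
independent of A, k, Ω and depending on d, M only, c₀ on α also».  b04's typed form
`B4.ThmPrinted`/`ThmPrintedNN` accordingly quantifies `∀ α ∃ (δ₀, c₀, R₀, e₁) ∀ instances` over a family whose
`bigBlocks` predicate (hence the block size) is fixed BEFORE `α`.  r01 g7's Hölder theorems
(`B4Thm19RegionLp.thm19_holder_region`, `B4Thm19RegionLpAll.thm19_holder_region_all`, r04's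
`thm19_holder_region_all_allF`) are STATED as `∀ α ∃ K …` although their cube size
`K = 16(⌈3^{d+1}√N·C_max·e⌉ + 1)` is built from the `α`-independent constants of Lemma 2.2 (2.17)/(2.20)/(2.21) and
Lemma 2.1 only (the `α`-dependent Hölder constant of (2.16), p35's `lemma22_holder_cubeField`, enters `c₀` alone).  This
file re-runs those three proofs VERBATIM with the quantifiers in the print's order `∃ K ∀ α ∃ c₀`, which is what the
family-level Theorem (`B4ThmRegionPairEta`) consumes — as p17 g5 did for boxes (`B4Thm19BoxHolderUniform` v2 `_unifK`).

WHAT THIS FILE PROVES (kernel, sorry-free).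
* `thm19_holder_region_unifK` — (1.9), close pairs `32|x−x′|_∞ ≤ ηM`, general `Ω` under `R₀`: `∃ K ≥ 16 (8 ∣ K) ∀ α ∈ [0,1)
  ∃ c₀ > 0 ∀ (c, β) ∃ e₁ > 0 …` (body of `thm19_holder_region`).
* `thm19_holder_region_all_unifK` — (1.9), all pairs `x ≠ x′` (body of `thm19_holder_region_all`, `K = K₁K₂`).
* `thm19_holder_region_all_allF_unifK` — (1.9), all pairs, for an ARBITRARY `f` at `ℓ^∞`-distance `≥ D` from both points,
  `≤ c₀·e^{−D/(2nK)}·‖f‖_∞` (body of r04's `thm19_holder_region_all_allF`).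
HONEST SCOPE.  Exactly that of the three source theorems (abelian one-parameter flow = (1.2), component field, staircase
contours on the cubes' boxes, `R₀` in label form with radius `K(d+4)`, `K` chosen after `d`, `N`, the flow's Lipschitz
constant, `L` and the windows — but NOT after `α`).  Theorems only; no definition, no `Prop` fact, no `sorry`; axioms
standard.
-/

namespace Literature.MathematicalPhysics.QuantumFieldTheory.Balaban1983to89.B4Thm19RegionUnifK


open Literature.MathematicalPhysics.QuantumFieldTheory.Balaban1983to89.B4Reflection242 (boxDom mem_boxDom nbrs mem_nbrs
  blk blk_mem_boxDom)
open Literature.MathematicalPhysics.QuantumFieldTheory.Balaban1983to89.B4GaugeCovariance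
open Literature.MathematicalPhysics.QuantumFieldTheory.Balaban1983to89.B4Commutators25to211 (mulH opK)
open Literature.MathematicalPhysics.QuantumFieldTheory.Balaban1983to89.B4Lower18 (fineDom mem_fineDom IsBlockUnion)
open Literature.MathematicalPhysics.QuantumFieldTheory.Balaban1983to89.B4Lower18Regular (e1 baseEmb stairContour
  base_le_of_blk)
open Literature.MathematicalPhysics.QuantumFieldTheory.Balaban1983to89.B4Lower18RegularRegion (regWt rBlkWt rbaseEmb
  rstairContour regWt_nonneg rBlkWt_ne_zero compField)
open Literature.MathematicalPhysics.QuantumFieldTheory.Balaban1983to89.B4Lemma21Region (regionOp regionDeriv siteNorm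
  covDeriv fld_covDeriv_mulVec_of_mem)
open Literature.MathematicalPhysics.QuantumFieldTheory.Balaban1983to89.B4Lemma22ReduceZero (Box opA greenA derivA)
open Literature.MathematicalPhysics.QuantumFieldTheory.Balaban1983to89.B4Lemma22Reduce231 (supN supN_nonneg le_supN
  supN_le siteNorm_nonneg siteNorm_zero fld_add)
open Literature.MathematicalPhysics.QuantumFieldTheory.Balaban1983to89.B4Lemma22EtaBox (vol vol_pos lpW lpW_nonneg)
open Literature.MathematicalPhysics.QuantumFieldTheory.Balaban1983to89.B4Lemma22LpStair (lpM lpM_nonneg)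
open Literature.MathematicalPhysics.QuantumFieldTheory.Balaban1983to89.B4PartitionUnity22 (hCube hCube_nonneg hCube_le_one
  hCube_ne_zero_imp mem_box_of_hCube_ne_zero hprof D1 D2 D1_nonneg D2_nonneg contDiff_hprof hasCompactSupport_hprof)
open Literature.MathematicalPhysics.QuantumFieldTheory.Balaban1983to89.B4Eq220PartitionSizes (hZ hBox)
open Literature.MathematicalPhysics.QuantumFieldTheory.Balaban1983to89.B4Eq220CommutatorField (kOp)
open Literature.MathematicalPhysics.QuantumFieldTheory.Balaban1983to89.B4CubeFields22 (cubeField cubeField_eq_compField)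
open Literature.MathematicalPhysics.QuantumFieldTheory.Balaban1983to89.B4CubeFieldHyps22 (aSeq_window cubeField_threshold)
open Literature.MathematicalPhysics.QuantumFieldTheory.Balaban1983to89.B4Eq220CubeField (lemma22_sup_cubeField
  eq220_cubeField_std eq221_cubeField)
open Literature.MathematicalPhysics.QuantumFieldTheory.Balaban1983to89.B4Eq221PsupCubeField (eq221_psup_cubeField_std)
open Literature.MathematicalPhysics.QuantumFieldTheory.Balaban1983to89.B4Eq221L2FactorRegion (acBond kOpR)
open Literature.MathematicalPhysics.QuantumFieldTheory.Balaban1983to89.B4Eq221HjRegion (eq221_l2_region_hZ hsizeR_hZ)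
open Literature.MathematicalPhysics.QuantumFieldTheory.Balaban1983to89.B4CubeOpReindex
open Literature.MathematicalPhysics.QuantumFieldTheory.Balaban1983to89.B4WalkRouteRegion (rpos labels labels_complete
  regWt_local rBlkWt_local green_mul_op)
open Literature.MathematicalPhysics.QuantumFieldTheory.Balaban1983to89.B4Ineq110WalkRoute (norm_mulH_le)
open Literature.MathematicalPhysics.QuantumFieldTheory.Balaban1983to89.B4Ineq110WalkRouteDeriv (unitOp_apply
  unitOp_mul_mulH norm_unitOp_le fld_bondOp_mulVec)
open Literature.MathematicalPhysics.QuantumFieldTheory.Balaban1983to89.B4Thm110BoxDerivWalk (probe_mul_mulH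
  fld_probe_mulVec_self fld_probe_mulVec_ne row_abs_sum_U_le)
open Literature.MathematicalPhysics.QuantumFieldTheory.Balaban1983to89.B4RegionCubeCarrier
open Literature.MathematicalPhysics.QuantumFieldTheory.Balaban1983to89.B4CubeGreenRegion
open Literature.MathematicalPhysics.QuantumFieldTheory.Balaban1983to89.B4LpNormTransfer
open Literature.MathematicalPhysics.QuantumFieldTheory.Balaban1983to89.B4Thm110RegionLp
open Literature.MathematicalPhysics.QuantumFieldTheory.Balaban1983to89.B4Ineq110LpChain (lpv lpv_nonneg lvl lvl_zero
  lvl_succ lpv_two_le)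
open Literature.MathematicalPhysics.QuantumFieldTheory.Balaban1983to89.B4Ineq19LpChain (ineq19_holder_lp_apply)
open Literature.MathematicalPhysics.QuantumFieldTheory.Balaban1983to89.B4Ineq19WalkRoute (holderOp_mul_mulH)
open Literature.MathematicalPhysics.QuantumFieldTheory.Balaban1983to89.B4ContourShift (supNorm supNorm_nonneg abs_le_supNorm)
open Literature.MathematicalPhysics.QuantumFieldTheory.Balaban1983to89.B4Lemma22HolderBox (IsNNChain transport_fieldLink)
open Literature.MathematicalPhysics.QuantumFieldTheory.Balaban1983to89.B4HolderChainTools (one_le_supNorm_of_ne)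
open Literature.MathematicalPhysics.QuantumFieldTheory.Balaban1983to89.B4Lemma22HolderCubeField (lemma22_holder_cubeField)
open Literature.MathematicalPhysics.QuantumFieldTheory.Balaban1983to89.B4Thm110RegionLpDeriv (chain_letter_inputs
  thm110_deriv_region)
open Literature.MathematicalPhysics.QuantumFieldTheory.Balaban1983to89.B4HolderLetterRegion
open Literature.MathematicalPhysics.QuantumFieldTheory.Balaban1983to89.B4Thm19RegionLp (thm19_holder_region_of_inputs)
open Literature.MathematicalPhysics.QuantumFieldTheory.Balaban1983to89.B4Thm19RegionLpAll (isBlockUnion_of_mul)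
open Literature.MathematicalPhysics.QuantumFieldTheory.Balaban1983to89.B4Thm19BoxHolderAll (rpow_le_max_one
  abs_U_mulVec_apply_le)
open Literature.MathematicalPhysics.QuantumFieldTheory.Balaban1983to89.B4Thm110RegionAllF (cubeSum_bound₂)
open Literature.MathematicalPhysics.QuantumFieldTheory.Balaban1983to89.B4Sect5Proof (latticeConst latticeConst_nonneg)
open scoped Matrix
open scoped Matrix.Norms.Operator

noncomputable section

variable {d : ℕ}

section Main

variable {ι : Type} [Fintype ι] [DecidableEq ι]

/-- **THEOREM p. 573, INEQUALITY (1.9) — the HÖLDER member — FOR A GENERAL REGION `Ω` UNDER `R₀`, CLOSE PAIRS, WITH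
THE CUBE SIZE CHOSEN BEFORE `α`** (print p. 573, verbatim: «there exist positive constants δ₀, c₀, R₀ independent of
A, k, Ω and depending on d, M only, c₀ on α also»): the statement of `B4Thm19RegionLp.thm19_holder_region` with the
quantifier order
`∃ K ≥ 16 (8 ∣ K) ∀ α ∈ [0,1) ∃ c₀ > 0 ∀ (c,β) ∃ e₁ > 0 …` — the proof of that theorem verbatim, observing that its cube size
`K = 16(⌈3^{d+1}√N·C_max·e⌉ + 1)` involves only the `α`-independent constants of Lemma 2.2 (2.17)/(2.20)/(2.21) and
Lemma 2.1, the `α`-dependent Hölder constant of (2.16) entering `c₀` only.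
[cite: Balaban1983RegularityDecay, Theorem p.573 (1.9); (1.3)–(1.4) p.572; §2 pp.575–579 (2.2)–(2.22)] -/
theorem thm19_holder_region_unifK (F : OrthFlow ι) {ℓ₁ : ℝ} (hℓ₁ : 0 ≤ ℓ₁)
    (hLip : ∀ t (v : ι → ℝ), ((F.U t - 1) *ᵥ v) ⬝ᵥ ((F.U t - 1) *ᵥ v) ≤ (ℓ₁ * t) ^ 2 * (v ⬝ᵥ v))
    (d ℓ : ℕ) (hℓ : 1 ≤ ℓ) (amin aplus m2plus : ℝ) (ha : 0 < amin) :
    ∃ K : ℕ, 16 ≤ K ∧ 8 ∣ K ∧ ∀ (α : ℝ), 0 ≤ α → α < 1 → ∃ c₀ : ℝ, 0 < c₀ ∧ ∀ (creg β : ℝ), 0 ≤ creg → 0 < β →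
      ∃ e₁ : ℝ, 0 < e₁ ∧ ∀ (k : ℕ), 1 ≤ k → ∀ (hn : 1 ≤ (ℓ + 1) ^ k) (a m2 : ℝ),
      amin ≤ a → a ≤ aplus → 0 ≤ m2 → m2 ≤ m2plus →
      ∀ (Ωc : Finset (Fin (d + 1) → ℤ)), IsBlockUnion K Ωc →
      ∀ (Ac : (Fin (d + 1) → ℤ) → Fin (d + 1) → ℝ) (e : ℝ), 0 < e → e ≤ e₁ →
        (∀ x ∈ fineDom ((ℓ + 1) ^ k) Ωc, ∀ μ ν : Fin (d + 1),
          |Ac (x + e1 μ) ν - Ac x ν| ≤ creg * e ^ (β - 1) / ((ℓ + 1) ^ k : ℕ)) →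
      ∀ (μ : Fin (d + 1)) (x x' : ↥(fineDom ((ℓ + 1) ^ k) Ωc)), x.1 + e1 μ ∈ fineDom ((ℓ + 1) ^ k) Ωc →
        x'.1 + e1 μ ∈ fineDom ((ℓ + 1) ^ k) Ωc → x'.1 ≠ x.1 →
        32 * supNorm (x'.1 - x.1) ≤ (((ℓ + 1) ^ k : ℕ) : ℝ) * K →
      ∀ (l : List ↥(fineDom ((ℓ + 1) ^ k) Ωc)), IsNNChain x l → pathEnd x l = x' →
        (l.length : ℝ) ≤ ((d : ℝ) + 1) * supNorm (x'.1 - x.1) →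
        (∀ z ∈ l, supNorm (z.1 - x.1) ≤ supNorm (x'.1 - x.1)) →
        (∀ y : Fin (d + 1) → ℤ, (∀ ν, |y ν - blk ((ℓ + 1) ^ k) x.1 ν| ≤ (K : ℤ) * (d + 4)) → y ∈ Ωc) →
      ∀ (P : ↥(fineDom ((ℓ + 1) ^ k) Ωc) → Prop) [DecidablePred P] (D : ℝ),
        (∀ x', P x' → ∃ ν, D ≤ |rpos ((ℓ + 1) ^ k) Ωc x ν - rpos ((ℓ + 1) ^ k) Ωc x' ν|) →
      ∀ (f : ↥(fineDom ((ℓ + 1) ^ k) Ωc) × ι → ℝ), (∀ p, ¬ P p.1 → f p = 0) →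
      ∀ (V : ℝ), 1 ≤ V → lpv (vol d ℓ k)⁻¹ 2 f ≤ V * ‖f‖ →
      ∀ i : ι,
        ((((ℓ + 1) ^ k : ℕ) : ℝ) / supNorm (x'.1 - x.1)) ^ α *
          |(transport (fieldLink F (e / ((ℓ + 1) ^ k : ℕ)) (acBond Ωc Ac)) x l
              *ᵥ fld (regionDeriv F e ((ℓ + 1) ^ k) Ωc Ac μ
                    *ᵥ ((regionOp F e hn (B1.aSeq a ((ℓ : ℝ) + 1) k) m2 Ωc Ac)⁻¹ *ᵥ f)) x'
            - fld (regionDeriv F e ((ℓ + 1) ^ k) Ωc Ac μ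
                    *ᵥ ((regionOp F e hn (B1.aSeq a ((ℓ : ℝ) + 1) k) m2 Ωc Ac)⁻¹ *ᵥ f)) x) i|
          ≤ c₀ * V * Real.exp (-(D / ((((ℓ + 1) ^ k : ℕ) : ℝ) * K))) * ‖f‖ := by
  -- the constants of the per-cube inputs (Lemma 2.2 at `Ã_j`, (2.20), (2.21), the graded factor; Lemma 2.1)
  obtain ⟨C₁, hC₁, h₁⟩ := lemma22_sup_cubeField F hℓ₁ hLip d ℓ hℓ amin aplus m2plus ha
  obtain ⟨C₂, hC₂, h₂⟩ := eq220_cubeField_std F hℓ₁ hLip d ℓ hℓ amin aplus m2plus ha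
  have hp₁ : (d : ℝ) + 1 < 2 * ((d : ℝ) + 1) := by
    have : (0 : ℝ) ≤ d := Nat.cast_nonneg d
    linarith
  obtain ⟨C₃, hC₃, h₃⟩ := eq221_cubeField F hℓ₁ hLip d ℓ hℓ amin aplus m2plus ha hp₁
  obtain ⟨C₄, hC₄, h₄⟩ := eq221_psup_cubeField_std F hℓ₁ hLip d ℓ hℓ amin aplus m2plus ha hp₁
  have hs : 0 ≤ ((d : ℝ) + 1) * (D1 hprof + D2 hprof) := by
    have := D1_nonneg contDiff_hprof hasCompactSupport_hprof
    have := D2_nonneg contDiff_hprof hasCompactSupport_hprof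
    positivity
  have hγ₀ : 0 < min 2 (3 / 4 * amin) / 4 := div_pos (lt_min two_pos (by linarith)) four_pos
  set C₅ : ℝ := (2 * ((d : ℝ) + 1) * (Real.sqrt (min 2 (3 / 4 * amin) / 4))⁻¹
      + (1 + |aplus|) * (min 2 (3 / 4 * amin) / 4)⁻¹) * (((d : ℝ) + 1) * (D1 hprof + D2 hprof)) with hC₅
  have hC₅0 : 0 ≤ C₅ := by
    have : 0 ≤ (Real.sqrt (min 2 (3 / 4 * amin) / 4))⁻¹ := inv_nonneg.2 (Real.sqrt_nonneg _)
    have : 0 ≤ (min 2 (3 / 4 * amin) / 4)⁻¹ := inv_nonneg.2 hγ₀.le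
    positivity
  set Cm : ℝ := C₂ + C₃ + C₄ + C₅ with hCm
  have hCm0 : 0 ≤ Cm := by positivity
  -- the cube size: `3^{d+1}·√N·C_max/K ≤ e^{−1}`, `8 ∣ K`
  set X : ℝ := (3 : ℝ) ^ (d + 1) * Real.sqrt (Fintype.card ι) * Cm * Real.exp 1 with hX
  have hX0 : 0 ≤ X := by positivity
  set K : ℕ := 16 * (⌈X⌉₊ + 1) with hK
  have hK16 : 16 ≤ K := by omega
  have hK8 : 8 ≤ K := by omega
  have h8 : 8 ∣ K := ⟨2 * (⌈X⌉₊ + 1), by omega⟩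
  have hK4 : 4 ∣ K := ⟨4 * (⌈X⌉₊ + 1), by omega⟩
  have hK2 : 2 ≤ K := by omega
  have hK1 : 1 ≤ K := by omega
  have hKr : (0 : ℝ) < K := by exact_mod_cast hK1
  have hKX : X ≤ K := by
    refine (Nat.le_ceil X).trans ?_
    rw [hK]
    push_cast
    linarith [(Nat.cast_nonneg ⌈X⌉₊ : (0 : ℝ) ≤ ⌈X⌉₊)]
  set cK : ℝ := Cm / K with hcK_def
  have hcK : 0 ≤ cK := div_nonneg hCm0 hKr.le
  have h3 : (3 : ℝ) ^ (d + 1) * (Real.sqrt (Fintype.card ι) * cK) ≤ Real.exp (-1) := by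
    have hexp : Real.exp 1 * Real.exp (-1) = 1 := by rw [← Real.exp_add]; norm_num
    have e : (3 : ℝ) ^ (d + 1) * (Real.sqrt (Fintype.card ι) * cK) = X / K * Real.exp (-1) := by
      rw [hcK_def, hX]
      calc (3 : ℝ) ^ (d + 1) * (Real.sqrt (Fintype.card ι) * (Cm / K))
          = (3 : ℝ) ^ (d + 1) * Real.sqrt (Fintype.card ι) * Cm / K * (Real.exp 1 * Real.exp (-1)) := by
            rw [hexp]; ring
        _ = (3 : ℝ) ^ (d + 1) * Real.sqrt (Fintype.card ι) * Cm * Real.exp 1 / K * Real.exp (-1) := by ring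
    rw [e]
    have : X / K ≤ 1 := div_le_one_of_le₀ hKX (Nat.cast_nonneg K)
    calc X / K * Real.exp (-1) ≤ 1 * Real.exp (-1) := mul_le_mul_of_nonneg_right this (Real.exp_pos _).le
      _ = Real.exp (-1) := one_mul _
  have hCle : ∀ {C : ℝ}, C ≤ Cm → C / K ≤ cK := fun h => div_le_div_of_nonneg_right h hKr.le
  have hC₂le : C₂ / K ≤ cK := hCle (by rw [hCm]; linarith)
  have hC₃le : C₃ / K ≤ cK := hCle (by rw [hCm]; linarith)
  have hC₄le : C₄ / K ≤ cK := hCle (by rw [hCm]; linarith)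
  have hC₅le : C₅ / K ≤ cK := hCle (by rw [hCm]; linarith)
  refine ⟨K, hK16, h8, fun α hα0 hα1 => ?_⟩
  -- the `α`-dependent Hölder constant of Lemma 2.2 (2.16), AFTER the cube size
  obtain ⟨C₆, hC₆, h₆⟩ := lemma22_holder_cubeField F hℓ₁ hLip d ℓ hℓ amin aplus m2plus ha α hα0 hα1
  -- the constant `c₀`
  set c₀ : ℝ := 2 ^ (d + 4) * Real.exp (5 / 2)
      * (Real.sqrt (Fintype.card ι) * (C₆ + ((d : ℝ) + 1) * D1 hprof * C₁
          + ((d : ℝ) + 3) * (((d : ℝ) + 1) * (D1 hprof + D2 hprof)) * C₁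
          + ((d : ℝ) + 1) * (D1 hprof ^ 2 + D2 hprof) * C₁)) + 1 with hc₀
  have hD1 := D1_nonneg contDiff_hprof hasCompactSupport_hprof
  have hD2 := D2_nonneg contDiff_hprof hasCompactSupport_hprof
  have hc₀0 : 0 < c₀ := by positivity
  refine ⟨c₀, hc₀0, fun creg β hcreg hβ => ?_⟩
  -- «for e sufficiently small»
  obtain ⟨e₁, he₁, h₁'⟩ := h₁ creg β hcreg hβ (2 * K) K hK1
  obtain ⟨e₂, he₂, h₂'⟩ := h₂ creg β hcreg hβ K hK2
  obtain ⟨e₃, he₃, h₃'⟩ := h₃ creg β hcreg hβ (2 * K) K hK2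
  obtain ⟨e₄, he₄, h₄'⟩ := h₄ creg β hcreg hβ K hK2
  obtain ⟨e₅, he₅, h₅'⟩ := cubeField_threshold d (c := 0) (aplus := aplus) hℓ₁ le_rfl ha hcreg hβ 1 K
  obtain ⟨e₆, he₆, h₆'⟩ := h₆ creg β hcreg hβ (2 * K) K hK1
  refine ⟨min (min (min (min e₁ e₂) (min e₃ e₄)) e₅) e₆,
    lt_min (lt_min (lt_min (lt_min he₁ he₂) (lt_min he₃ he₄)) he₅) he₆, ?_⟩
  intro k hk hn a m2 ea1 ea2 em1 em2 Ωc hΩ Ac e he hle' h17 μ x x' hxμ hx'μ hne hclose l hl hlend hlen hlnear hxR P _ D hD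
    f hfP V hV hfV i
  have hle : e ≤ min (min (min e₁ e₂) (min e₃ e₄)) e₅ := hle'.trans (min_le_left _ _)
  have hle₆ : e ≤ e₆ := hle'.trans (min_le_right _ _)
  have hle₁ : e ≤ e₁ := hle.trans ((min_le_left _ _).trans ((min_le_left _ _).trans (min_le_left _ _)))
  have hle₂ : e ≤ e₂ := hle.trans ((min_le_left _ _).trans ((min_le_left _ _).trans (min_le_right _ _)))
  have hle₃ : e ≤ e₃ := hle.trans ((min_le_left _ _).trans ((min_le_right _ _).trans (min_le_left _ _)))
  have hle₄ : e ≤ e₄ := hle.trans ((min_le_left _ _).trans ((min_le_right _ _).trans (min_le_right _ _)))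
  have hle₅ : e ≤ e₅ := hle.trans (min_le_right _ _)
  have hn2 : 2 ≤ (ℓ + 1) ^ k := by
    calc 2 ≤ ℓ + 1 := by omega
      _ = (ℓ + 1) ^ 1 := (pow_one _).symm
      _ ≤ (ℓ + 1) ^ k := Nat.pow_le_pow_right (Nat.succ_pos ℓ) hk
  have hnK : 16 ≤ (ℓ + 1) ^ k * K := le_trans (by norm_num) (Nat.mul_le_mul hn2 hK8)
  have hnK3 : 3 ≤ (ℓ + 1) ^ k * K := le_trans (by norm_num) hnK
  have ha' : 0 < a := lt_of_lt_of_le ha ea1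
  have hL : (1 : ℝ) < (ℓ : ℝ) + 1 := by
    have : (1 : ℝ) ≤ ℓ := by exact_mod_cast hℓ
    linarith
  have hak : 0 < B1.aSeq a ((ℓ : ℝ) + 1) k := B1.aSeq_pos ha' hL hk
  obtain ⟨hak1, hak2⟩ := aSeq_window hℓ hk ha ea1 ea2
  have hvol : 0 ≤ (vol d ℓ k)⁻¹ ^ (2 : ℝ)⁻¹ := Real.rpow_nonneg (inv_nonneg.2 (vol_pos d ℓ k).le) _
  -- the standard box data
  have hM1 : ∀ _i : Fin (d + 1), 1 ≤ 2 * K := fun _ => by omega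
  have hMS : ∀ _i : Fin (d + 1), 2 * K ≤ 2 * K := fun _ => le_rfl
  have hKM : ∀ _i : Fin (d + 1), K ∣ 2 * K := fun _ => Dvd.intro_left 2 rfl
  have hj1 : ∀ _i : Fin (d + 1), (1 : ℤ) ≤ 1 := fun _ => le_rfl
  have hj2 : ∀ _i : Fin (d + 1), (K : ℤ) * (1 + 1) ≤ ((2 * K : ℕ) : ℤ) := fun _ => by push_cast; omega
  -- the main chain with the inputs discharged
  have main := thm19_holder_region_of_inputs F (e / ((ℓ + 1) ^ k : ℕ)) hℓ hk hn Ωc hK16 hK4 ha' em1 Ac hC₁.le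
    hcK (n₀ := d + 1) (Nat.succ_pos d)
    -- Lemma 2.2 (2.17), sup member, at `Ã_j`
    (fun j hj Φ => (h₁' k hk hn hnK a m2 ea1 ea2 em1 em2 (fun _ => 2 * K) hM1 hMS (fun _ => 1) hj1 hj2
      (AcS ℓ k K Ac j) e he hle₁ (regular_AcS h17 hj) Φ).1)
    -- (2.20)
    (fun j hj Φ => (h₂' k hk hn hnK a m2 ea1 ea2 em1 em2 (AcS ℓ k K Ac j) e he hle₂ (regular_AcS h17 hj) Φ).trans
      (mul_le_mul_of_nonneg_right hC₂le (supN_nonneg Φ)))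
    -- the graded factor `‖·‖_{∞,p₁}` of (2.21)
    (fun j hj p hp Φ => by
      have hp' : 2 * ((d : ℝ) + 1) ≤ p := by push_cast at hp; linarith
      exact (h₄' k hk hn hnK a m2 ea1 ea2 em1 em2 (AcS ℓ k K Ac j) e he hle₄ (regular_AcS h17 hj) p hp' Φ).trans
        (mul_le_mul_of_nonneg_right hC₄le (lpW_nonneg d ℓ k p Φ)))
    -- (2.21)
    (fun j hj p q hp hpq hdiff Φ => by
      have hdiff' : p⁻¹ - q⁻¹ ≤ (2 * ((d : ℝ) + 1))⁻¹ := by push_cast at hdiff; exact hdiff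
      exact (h₃' k hk hn hnK a m2 ea1 ea2 em1 em2 (fun _ => 2 * K) hM1 hMS hKM (fun _ => 1) hj1 hj2
        (AcS ℓ k K Ac j) e he hle₃ (regular_AcS h17 hj) p q hp hpq hdiff' Φ).trans
        (mul_le_mul_of_nonneg_right hC₃le (lpW_nonneg d ℓ k p Φ)))
    -- Lemma 2.1's `‖·‖_{2,2}` at every cube, on the sub-region `Ω ∩ □̂_j`
    (fun j Φ => by
      obtain ⟨_, hsm, _⟩ := h₅' e he hle₅ _ hak1 hak2
      have hsmall : ℓ₁ ^ 2 * (((d : ℝ) + 1) * creg * e ^ β) ^ 2 * ((d : ℝ) + 1)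
          * (1 + B1.aSeq a ((ℓ : ℝ) + 1) k * ((d : ℝ) + 1)) ≤ min 2 (B1.aSeq a ((ℓ : ℝ) + 1) k) / 4 := by
        simpa only [Nat.cast_one, mul_one] using hsm
      have hL := eq221_l2_region_hZ F hℓ₁ hLip he hn hak em1 (subLabels Ωc K j) hcreg
        (fun y hy => h17 y (fineDom_mono hn (subLabels_subset Ωc K j) hy)) hsmall hnK3
        (isBlockUnion_subLabels Ωc hK1 hΩ j) j Φ
      have step : lpM 2 (kOpR F e hn (B1.aSeq a ((ℓ : ℝ) + 1) k) m2 (subLabels Ωc K j) Ac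
            (fun x => hZ ((ℓ + 1) ^ k) K j x.1)
          *ᵥ ((regionOp F e hn (B1.aSeq a ((ℓ : ℝ) + 1) k) m2 (subLabels Ωc K j) Ac)⁻¹
            *ᵥ (mulH (ι := ι) (fun x : ↥(fineDom ((ℓ + 1) ^ k) (subLabels Ωc K j)) => hZ ((ℓ + 1) ^ k) K j x.1)
              *ᵥ Φ))) ≤ cK * lpM 2 Φ := by
        refine hL.trans (mul_le_mul_of_nonneg_right ?_ (lpM_nonneg 2 Φ))
        refine le_trans ?_ hC₅le
        rw [hC₅]
        calc (2 * ((d : ℝ) + 1) * (Real.sqrt (min 2 (B1.aSeq a ((ℓ : ℝ) + 1) k) / 4 + m2))⁻¹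
              + (1 + B1.aSeq a ((ℓ : ℝ) + 1) k) * (min 2 (B1.aSeq a ((ℓ : ℝ) + 1) k) / 4 + m2)⁻¹)
              * (((d : ℝ) + 1) * (D1 hprof + D2 hprof)) / K
            = (2 * ((d : ℝ) + 1) * (Real.sqrt (min 2 (B1.aSeq a ((ℓ : ℝ) + 1) k) / 4 + m2))⁻¹
              + (1 + B1.aSeq a ((ℓ : ℝ) + 1) k) * (min 2 (B1.aSeq a ((ℓ : ℝ) + 1) k) / 4 + m2)⁻¹)
              * (((d : ℝ) + 1) * (D1 hprof + D2 hprof)) * (K : ℝ)⁻¹ := div_eq_mul_inv _ _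
          _ ≤ (2 * ((d : ℝ) + 1) * (Real.sqrt (min 2 (3 / 4 * amin) / 4))⁻¹
              + (1 + |aplus|) * (min 2 (3 / 4 * amin) / 4)⁻¹) * (((d : ℝ) + 1) * (D1 hprof + D2 hprof))
              * (K : ℝ)⁻¹ := mul_le_mul_of_nonneg_right (l2_const_le d ha hak1 hak2 em1 hs) (inv_nonneg.2 hKr.le)
          _ = _ := (div_eq_mul_inv _ _).symm
      show (vol d ℓ k)⁻¹ ^ (2 : ℝ)⁻¹ * lpM 2 _ ≤ cK * ((vol d ℓ k)⁻¹ ^ (2 : ℝ)⁻¹ * lpM 2 Φ)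
      calc (vol d ℓ k)⁻¹ ^ (2 : ℝ)⁻¹ * lpM 2 _ ≤ (vol d ℓ k)⁻¹ ^ (2 : ℝ)⁻¹ * (cK * lpM 2 Φ) :=
            mul_le_mul_of_nonneg_left step hvol
        _ = cK * ((vol d ℓ k)⁻¹ ^ (2 : ℝ)⁻¹ * lpM 2 Φ) := by ring)
    hC₁.le hC₆.le μ
    -- Lemma 2.2 (2.17), derivative sup members, at `Ã_j`
    (fun j hj ν Φ => ((h₁' k hk hn hnK a m2 ea1 ea2 em1 em2 (fun _ => 2 * K) hM1 hMS (fun _ => 1) hj1 hj2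
      (AcS ℓ k K Ac j) e he hle₁ (regular_AcS h17 hj) Φ).2 ν))
    hα0 hα1.le
    -- Lemma 2.2 (2.16), the Hölder member, at `Ã_j`
    (fun j hj a0 a0' ha0μ ha0'μ hneB lB hlB hlendB hlenB Φ =>
      h₆' k hk hn hnK a m2 ea1 ea2 em1 em2 (fun _ => 2 * K) hM1 hMS (fun _ => 1) hj1 hj2 (AcS ℓ k K Ac j) e he hle₆
        (regular_AcS h17 hj) μ a0 ⟨a0.1 + e1 μ, ha0μ⟩ a0' ⟨a0'.1 + e1 μ, ha0'μ⟩ rfl rfl hneB lB hlB hlendB hlenB Φ)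
    h3 x x' hxμ hx'μ hne hclose l hl hlend hlen hlnear
    (fun y hy => hxR y fun ν => by have h := hy ν; push_cast at h ⊢; linarith)
    P hD f hfP hV hfV i
  have hreg : regionOp F e hn (B1.aSeq a ((ℓ : ℝ) + 1) k) m2 Ωc Ac
      = covOp (regWt ((ℓ + 1) ^ k) (fineDom ((ℓ + 1) ^ k) Ωc)) m2
          (B1.aSeq a ((ℓ : ℝ) + 1) k * (((((ℓ + 1) ^ k : ℕ)) : ℝ) ^ (d + 1))⁻¹)
          (rBlkWt ((ℓ + 1) ^ k) Ωc (fineDom ((ℓ + 1) ^ k) Ωc)) (fieldLink F (e / ((ℓ + 1) ^ k : ℕ)) (acBond Ωc Ac))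
          (contourTrans (fieldLink F (e / ((ℓ + 1) ^ k : ℕ)) (acBond Ωc Ac)) (rbaseEmb hn Ωc)
            (rstairContour hn Ωc)) := rfl
  have hder : regionDeriv F e ((ℓ + 1) ^ k) Ωc Ac μ
      = covDeriv ((ℓ + 1) ^ k) (fineDom ((ℓ + 1) ^ k) Ωc) (fieldLink F (e / ((ℓ + 1) ^ k : ℕ)) (acBond Ωc Ac)) μ :=
    rfl
  rw [hreg, hder]
  have hV0 : 0 ≤ V := zero_le_one.trans hV
  refine main.trans ?_
  have hrest : 0 ≤ V * Real.exp (-(D / ((((ℓ + 1) ^ k : ℕ) : ℝ) * K))) * ‖f‖ := by positivity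
  have hle : 2 ^ (d + 4) * Real.exp (5 / 2)
        * (Real.sqrt (Fintype.card ι) * (C₆ + ((d : ℝ) + 1) * D1 hprof * C₁
            + ((d : ℝ) + 3) * (((d : ℝ) + 1) * (D1 hprof + D2 hprof)) * C₁
            + ((d : ℝ) + 1) * (D1 hprof ^ 2 + D2 hprof) * C₁)) ≤ c₀ := by
    rw [hc₀]; linarith
  calc 2 ^ (d + 4) * Real.exp (5 / 2)
        * (Real.sqrt (Fintype.card ι) * (C₆ + ((d : ℝ) + 1) * D1 hprof * C₁
            + ((d : ℝ) + 3) * (((d : ℝ) + 1) * (D1 hprof + D2 hprof)) * C₁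
            + ((d : ℝ) + 1) * (D1 hprof ^ 2 + D2 hprof) * C₁))
        * V * Real.exp (-(D / ((((ℓ + 1) ^ k : ℕ) : ℝ) * K))) * ‖f‖
      = (2 ^ (d + 4) * Real.exp (5 / 2)
        * (Real.sqrt (Fintype.card ι) * (C₆ + ((d : ℝ) + 1) * D1 hprof * C₁
            + ((d : ℝ) + 3) * (((d : ℝ) + 1) * (D1 hprof + D2 hprof)) * C₁
            + ((d : ℝ) + 1) * (D1 hprof ^ 2 + D2 hprof) * C₁)))
        * (V * Real.exp (-(D / ((((ℓ + 1) ^ k : ℕ) : ℝ) * K))) * ‖f‖) := by ring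
    _ ≤ c₀ * (V * Real.exp (-(D / ((((ℓ + 1) ^ k : ℕ) : ℝ) * K))) * ‖f‖) := mul_le_mul_of_nonneg_right hle hrest
    _ = c₀ * V * Real.exp (-(D / ((((ℓ + 1) ^ k : ℕ) : ℝ) * K))) * ‖f‖ := by ring

/-- **THEOREM p. 573, INEQUALITY (1.9) — the HÖLDER member — GENERAL `Ω` UNDER `R₀`, ALL PAIRS `x ≠ x′`, η-UNIFORM, WITH
THE CUBE SIZE CHOSEN BEFORE `α`**: `B4Thm19RegionLpAll.thm19_holder_region_all` in the order `∃ K ∀ α ∃ c₀ …` — its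
proof verbatim on `thm19_holder_region_unifK` (close pairs) and the `α`-free derivative member
`B4Thm110RegionLpDeriv.thm110_deriv_region` (far pairs), `K = K₁K₂`.
[cite: Balaban1983RegularityDecay, Theorem p.573 (1.9)–(1.10); (1.3)–(1.4) p.572; §2 pp.575–579] -/
theorem thm19_holder_region_all_unifK (F : OrthFlow ι) {ℓ₁ : ℝ} (hℓ₁ : 0 ≤ ℓ₁)
    (hLip : ∀ t (v : ι → ℝ), ((F.U t - 1) *ᵥ v) ⬝ᵥ ((F.U t - 1) *ᵥ v) ≤ (ℓ₁ * t) ^ 2 * (v ⬝ᵥ v))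
    (d ℓ : ℕ) (hℓ : 1 ≤ ℓ) (amin aplus m2plus : ℝ) (ha : 0 < amin) :
    ∃ K : ℕ, 16 ≤ K ∧ 8 ∣ K ∧ ∀ (α : ℝ), 0 ≤ α → α < 1 → ∃ c₀ : ℝ, 0 < c₀ ∧ ∀ (creg β : ℝ), 0 ≤ creg → 0 < β →
      ∃ e₁ : ℝ, 0 < e₁ ∧ ∀ (k : ℕ), 1 ≤ k → ∀ (hn : 1 ≤ (ℓ + 1) ^ k) (a m2 : ℝ),
      amin ≤ a → a ≤ aplus → 0 ≤ m2 → m2 ≤ m2plus →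
      ∀ (Ωc : Finset (Fin (d + 1) → ℤ)), IsBlockUnion K Ωc →
      ∀ (Ac : (Fin (d + 1) → ℤ) → Fin (d + 1) → ℝ) (e : ℝ), 0 < e → e ≤ e₁ →
        (∀ x ∈ fineDom ((ℓ + 1) ^ k) Ωc, ∀ μ ν : Fin (d + 1),
          |Ac (x + e1 μ) ν - Ac x ν| ≤ creg * e ^ (β - 1) / ((ℓ + 1) ^ k : ℕ)) →
      ∀ (μ : Fin (d + 1)) (x x' : ↥(fineDom ((ℓ + 1) ^ k) Ωc)), x.1 + e1 μ ∈ fineDom ((ℓ + 1) ^ k) Ωc →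
        x'.1 + e1 μ ∈ fineDom ((ℓ + 1) ^ k) Ωc → x'.1 ≠ x.1 →
      ∀ (l : List ↥(fineDom ((ℓ + 1) ^ k) Ωc)), IsNNChain x l → pathEnd x l = x' →
        (l.length : ℝ) ≤ ((d : ℝ) + 1) * supNorm (x'.1 - x.1) →
        (∀ z ∈ l, supNorm (z.1 - x.1) ≤ supNorm (x'.1 - x.1)) →
        (∀ y : Fin (d + 1) → ℤ, (∀ ν, |y ν - blk ((ℓ + 1) ^ k) x.1 ν| ≤ (K : ℤ) * (d + 4)) → y ∈ Ωc) →
        (∀ y : Fin (d + 1) → ℤ, (∀ ν, |y ν - blk ((ℓ + 1) ^ k) x'.1 ν| ≤ (K : ℤ) * (d + 4)) → y ∈ Ωc) →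
      ∀ (P : ↥(fineDom ((ℓ + 1) ^ k) Ωc) → Prop) [DecidablePred P] (D : ℝ), 0 ≤ D →
        (∀ x'', P x'' → ∃ ν, D ≤ |rpos ((ℓ + 1) ^ k) Ωc x ν - rpos ((ℓ + 1) ^ k) Ωc x'' ν|) →
        (∀ x'', P x'' → ∃ ν, D ≤ |rpos ((ℓ + 1) ^ k) Ωc x' ν - rpos ((ℓ + 1) ^ k) Ωc x'' ν|) →
      ∀ (f : ↥(fineDom ((ℓ + 1) ^ k) Ωc) × ι → ℝ), (∀ p, ¬ P p.1 → f p = 0) →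
      ∀ (V : ℝ), 1 ≤ V → lpv (vol d ℓ k)⁻¹ 2 f ≤ V * ‖f‖ →
      ∀ i : ι,
        ((((ℓ + 1) ^ k : ℕ) : ℝ) / supNorm (x'.1 - x.1)) ^ α *
          |(transport (fieldLink F (e / ((ℓ + 1) ^ k : ℕ)) (acBond Ωc Ac)) x l
              *ᵥ fld (regionDeriv F e ((ℓ + 1) ^ k) Ωc Ac μ
                    *ᵥ ((regionOp F e hn (B1.aSeq a ((ℓ : ℝ) + 1) k) m2 Ωc Ac)⁻¹ *ᵥ f)) x'
            - fld (regionDeriv F e ((ℓ + 1) ^ k) Ωc Ac μ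
                    *ᵥ ((regionOp F e hn (B1.aSeq a ((ℓ : ℝ) + 1) k) m2 Ωc Ac)⁻¹ *ᵥ f)) x) i|
          ≤ c₀ * V * Real.exp (-(D / ((((ℓ + 1) ^ k : ℕ) : ℝ) * K))) * ‖f‖ := by
  classical
  obtain ⟨K₁, hK₁, h8₁, HU₁⟩ := thm19_holder_region_unifK F hℓ₁ hLip d ℓ hℓ amin aplus m2plus ha
  obtain ⟨K₂, hK₂, -, c₂, hc₂, H₂⟩ := thm110_deriv_region F hℓ₁ hLip d ℓ hℓ amin aplus m2plus ha
  set K : ℕ := K₁ * K₂ with hK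
  have hK₂1 : 1 ≤ K₂ := le_trans (by norm_num) hK₂
  have hK₁1 : 1 ≤ K₁ := le_trans (by norm_num) hK₁
  have hK₁K : K₁ ≤ K := by rw [hK]; nlinarith
  have hK₂K : K₂ ≤ K := by rw [hK]; nlinarith
  have hK₂K' : 16 * K₂ ≤ K := by rw [hK]; nlinarith
  have hK16 : 16 ≤ K := hK₁.trans hK₁K
  have h8 : 8 ∣ K := dvd_mul_of_dvd_left h8₁ K₂
  have hK₁r : (0 : ℝ) < K₁ := by exact_mod_cast lt_of_lt_of_le (by norm_num) hK₁
  have hK₂r : (0 : ℝ) < K₂ := by exact_mod_cast lt_of_lt_of_le (by norm_num) hK₂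
  have hKr : (0 : ℝ) < K := by exact_mod_cast lt_of_lt_of_le (by norm_num) hK16
  refine ⟨K, hK16, h8, fun α hα0 hα1 => ?_⟩
  obtain ⟨c₁, hc₁, H₁⟩ := HU₁ α hα0 hα1
  set c : ℝ := max c₁ (2 * (((Fintype.card ι : ℝ) + 1) * c₂)) with hc
  refine ⟨c, lt_of_lt_of_le hc₁ (le_max_left _ _), fun creg β hcreg hβ => ?_⟩
  obtain ⟨e₁, he₁, H₁'⟩ := H₁ creg β hcreg hβ
  obtain ⟨e₂, he₂, H₂'⟩ := H₂ creg β hcreg hβ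
  refine ⟨min e₁ e₂, lt_min he₁ he₂, ?_⟩
  intro k hk hn a m2 ea1 ea2 em1 em2 Ωc hΩ Ac e he hle h17 μ x x' hxμ hx'μ hne l hl hlend hlen hlnear hRx hRx' P _ D hD0 hD
    hD' f hfP V hV hfV i
  have hnr : (0 : ℝ) < (((ℓ + 1) ^ k : ℕ) : ℝ) := by exact_mod_cast hn
  have hV0 : (0 : ℝ) ≤ V := zero_le_one.trans hV
  -- `Ω` is a union of `K₁`-blocks and of `K₂`-blocks
  have hΩ₁ : IsBlockUnion K₁ Ωc := isBlockUnion_of_mul (K₂ := K₂) (by rw [← hK]; exact hΩ)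
  have hΩ₂ : IsBlockUnion K₂ Ωc := isBlockUnion_of_mul (K₂ := K₁) (by rw [mul_comm, ← hK]; exact hΩ)
  -- the `R₀` restrictions of the two theorems
  have hR₁ : ∀ y : Fin (d + 1) → ℤ, (∀ ν, |y ν - blk ((ℓ + 1) ^ k) x.1 ν| ≤ (K₁ : ℤ) * (d + 4)) → y ∈ Ωc := by
    intro y hy
    refine hRx y fun ν => (hy ν).trans ?_
    have : (K₁ : ℤ) ≤ K := by exact_mod_cast hK₁K
    nlinarith
  have hR₂ : ∀ (z : ↥(fineDom ((ℓ + 1) ^ k) Ωc)),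
      (∀ y : Fin (d + 1) → ℤ, (∀ ν, |y ν - blk ((ℓ + 1) ^ k) z.1 ν| ≤ (K : ℤ) * (d + 4)) → y ∈ Ωc) →
      ∀ y : Fin (d + 1) → ℤ, (∀ ν, |y ν - blk ((ℓ + 1) ^ k) z.1 ν| ≤ (K₂ : ℤ) * (d + 3) + 1) → y ∈ Ωc := by
    intro z hz y hy
    refine hz y fun ν => (hy ν).trans ?_
    have h1 : (16 : ℤ) * K₂ ≤ K := by exact_mod_cast hK₂K'
    have h2 : (1 : ℤ) ≤ K₂ := by exact_mod_cast hK₂1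
    nlinarith
  -- `e^{−D/(nKᵢ)} ≤ e^{−D/(nK)}`
  have hexpK : ∀ K' : ℕ, (0 : ℝ) < K' → K' ≤ K →
      Real.exp (-(D / ((((ℓ + 1) ^ k : ℕ) : ℝ) * K'))) ≤ Real.exp (-(D / ((((ℓ + 1) ^ k : ℕ) : ℝ) * K))) := by
    intro K' hK'0 hK'
    refine Real.exp_le_exp.2 (neg_le_neg (div_le_div_of_nonneg_left hD0 (by positivity) ?_))
    exact mul_le_mul_of_nonneg_left (by exact_mod_cast hK') hnr.le
  have hrest : 0 ≤ V * Real.exp (-(D / ((((ℓ + 1) ^ k : ℕ) : ℝ) * K))) * ‖f‖ := by positivity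
  by_cases hclose : 32 * supNorm (x'.1 - x.1) ≤ (((ℓ + 1) ^ k : ℕ) : ℝ) * K₁
  · -- close pairs: the random-walk expansion for the Hölder probe
    have hb := H₁' k hk hn a m2 ea1 ea2 em1 em2 Ωc hΩ₁ Ac e he (hle.trans (min_le_left _ _)) h17 μ x x' hxμ hx'μ hne
      hclose l hl hlend hlen hlnear hR₁ P D hD f hfP V hV hfV i
    refine hb.trans ?_
    calc c₁ * V * Real.exp (-(D / ((((ℓ + 1) ^ k : ℕ) : ℝ) * K₁))) * ‖f‖
        = c₁ * (V * Real.exp (-(D / ((((ℓ + 1) ^ k : ℕ) : ℝ) * K₁))) * ‖f‖) := by ring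
      _ ≤ c * (V * Real.exp (-(D / ((((ℓ + 1) ^ k : ℕ) : ℝ) * K))) * ‖f‖) := by
          refine mul_le_mul (le_max_left _ _) ?_ (by positivity) (hc₁.le.trans (le_max_left _ _))
          exact mul_le_mul_of_nonneg_right (mul_le_mul_of_nonneg_left (hexpK K₁ hK₁r hK₁K) hV0) (norm_nonneg _)
      _ = c * V * Real.exp (-(D / ((((ℓ + 1) ^ k : ℕ) : ℝ) * K))) * ‖f‖ := by ring
  · -- far pairs: Hölder weight `≤ 2`, derivative member at `x` and at `x′`
    set r : ℝ := supNorm (x'.1 - x.1) with hr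
    have hr0 : 0 < r := lt_of_lt_of_le zero_lt_one (one_le_supNorm_of_ne hne)
    have hw2 : ((((ℓ + 1) ^ k : ℕ) : ℝ) / r) ^ α ≤ 2 := by
      refine (rpow_le_max_one (div_nonneg hnr.le hr0.le) hα0 hα1.le).trans (max_le (by norm_num) ?_)
      rw [div_le_iff₀ hr0]
      have hK₁16 : (16 : ℝ) ≤ K₁ := by exact_mod_cast hK₁
      push Not at hclose
      nlinarith
    have hx1 := H₂' k hk hn a m2 ea1 ea2 em1 em2 Ωc hΩ₂ Ac e he (hle.trans (min_le_right _ _)) h17 μ x hxμ (hR₂ x hRx)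
      P D hD f hfP V hV hfV
    have hx2 := H₂' k hk hn a m2 ea1 ea2 em1 em2 Ωc hΩ₂ Ac e he (hle.trans (min_le_right _ _)) h17 μ x' hx'μ
      (hR₂ x' hRx') P D hD' f hfP V hV hfV
    set Ψ := regionDeriv F e ((ℓ + 1) ^ k) Ωc Ac μ
      *ᵥ ((regionOp F e hn (B1.aSeq a ((ℓ : ℝ) + 1) k) m2 Ωc Ac)⁻¹ *ᵥ f) with hΨ
    have hb0 : 0 ≤ c₂ * V * Real.exp (-(D / ((((ℓ + 1) ^ k : ℕ) : ℝ) * K₂))) * ‖f‖ := by positivity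
    have hU : |(transport (fieldLink F (e / ((ℓ + 1) ^ k : ℕ)) (acBond Ωc Ac)) x l *ᵥ fld Ψ x') i|
        ≤ (Fintype.card ι : ℝ) * (c₂ * V * Real.exp (-(D / ((((ℓ + 1) ^ k : ℕ) : ℝ) * K₂))) * ‖f‖) := by
      rw [transport_fieldLink]
      exact abs_U_mulVec_apply_le F _ _ hb0 (fun k' => hx2 k') i
    have hVx : |fld Ψ x i| ≤ c₂ * V * Real.exp (-(D / ((((ℓ + 1) ^ k : ℕ) : ℝ) * K₂))) * ‖f‖ := hx1 i
    have hdiff : |(transport (fieldLink F (e / ((ℓ + 1) ^ k : ℕ)) (acBond Ωc Ac)) x l *ᵥ fld Ψ x' - fld Ψ x) i|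
        ≤ ((Fintype.card ι : ℝ) + 1) * (c₂ * V * Real.exp (-(D / ((((ℓ + 1) ^ k : ℕ) : ℝ) * K₂))) * ‖f‖) := by
      rw [Pi.sub_apply]
      refine (abs_sub _ _).trans ?_
      linarith
    have hw0 : 0 ≤ ((((ℓ + 1) ^ k : ℕ) : ℝ) / r) ^ α := Real.rpow_nonneg (div_nonneg hnr.le hr0.le) α
    calc ((((ℓ + 1) ^ k : ℕ) : ℝ) / r) ^ α
          * |(transport (fieldLink F (e / ((ℓ + 1) ^ k : ℕ)) (acBond Ωc Ac)) x l *ᵥ fld Ψ x' - fld Ψ x) i|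
        ≤ 2 * (((Fintype.card ι : ℝ) + 1) * (c₂ * V * Real.exp (-(D / ((((ℓ + 1) ^ k : ℕ) : ℝ) * K₂))) * ‖f‖)) :=
          mul_le_mul hw2 hdiff (abs_nonneg _) zero_le_two
      _ = 2 * (((Fintype.card ι : ℝ) + 1) * c₂) * (V * Real.exp (-(D / ((((ℓ + 1) ^ k : ℕ) : ℝ) * K₂))) * ‖f‖) := by
          ring
      _ ≤ c * (V * Real.exp (-(D / ((((ℓ + 1) ^ k : ℕ) : ℝ) * K))) * ‖f‖) := by
          refine mul_le_mul (le_max_right _ _) ?_ (by positivity) (hc₁.le.trans (le_max_left _ _))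
          exact mul_le_mul_of_nonneg_right (mul_le_mul_of_nonneg_left (hexpK K₂ hK₂r hK₂K) hV0) (norm_nonneg _)
      _ = c * V * Real.exp (-(D / ((((ℓ + 1) ^ k : ℕ) : ℝ) * K))) * ‖f‖ := by ring

omit [DecidableEq ι] in
/-- additivity in `f` of the Hölder probe `c·((U(Γ)·(Φ_f)(x′) − (Φ_f)(x))_i)`, `Φ_f = N f`. [folklore] -/
private theorem holder_expr_sum {Y : Type} [Fintype Y] [DecidableEq ι] (c : ℝ) (T : Matrix ι ι ℝ)
    (N : Matrix (Y × ι) (Y × ι) ℝ) (x x' : Y) (i : ι) {σ : Type} (s : Finset σ) (g : σ → (Y × ι → ℝ)) :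
    c * ((T *ᵥ fld (N *ᵥ ∑ y ∈ s, g y) x' - fld (N *ᵥ ∑ y ∈ s, g y) x) i)
      = ∑ y ∈ s, c * ((T *ᵥ fld (N *ᵥ g y) x' - fld (N *ᵥ g y) x) i) := by
  classical
  have h1 : ∀ z, fld (N *ᵥ ∑ y ∈ s, g y) z = ∑ y ∈ s, fld (N *ᵥ g y) z := by
    intro z; funext j; simp [fld, Matrix.mulVec_sum, Finset.sum_apply]
  rw [h1, h1, Matrix.mulVec_sum, ← Finset.sum_sub_distrib, Finset.sum_apply, Finset.mul_sum]

/-- **THEOREM (1.9), HÖLDER member, ALL PAIRS, GENERAL `Ω` UNDER `R₀`, ARBITRARY `f`, CUBE SIZE BEFORE `α`** — r04 g8's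
`B4Thm110RegionAllF.thm19_holder_region_all_allF` (the two-base-point cube summation `cubeSum_bound₂` of the unit-block
form) in the order `∃ K ∀ α ∃ c₀ …`, its proof verbatim on `thm19_holder_region_all_unifK`:
`(η⁻¹/|x−x′|_∞)^α·|U(A(Γ))(D^η_{A,μ}G_k(Ω,A)f)(x′) − (D^η_{A,μ}G_k(Ω,A)f)(x)|_i ≤ c₀·e^{−D/(2nK)}·‖f‖_∞` for EVERY `f`
at `ℓ^∞`-distance `≥ D` from both points. [cite: Balaban1983RegularityDecay, Theorem p.573 (1.9); §2 ¶1 p.575] -/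
theorem thm19_holder_region_all_allF_unifK (F : OrthFlow ι) {ℓ₁ : ℝ} (hℓ₁ : 0 ≤ ℓ₁)
    (hLip : ∀ t (v : ι → ℝ), ((F.U t - 1) *ᵥ v) ⬝ᵥ ((F.U t - 1) *ᵥ v) ≤ (ℓ₁ * t) ^ 2 * (v ⬝ᵥ v))
    (d ℓ : ℕ) (hℓ : 1 ≤ ℓ) (amin aplus m2plus : ℝ) (ha : 0 < amin) :
    ∃ K : ℕ, 16 ≤ K ∧ 8 ∣ K ∧ ∀ (α : ℝ), 0 ≤ α → α < 1 → ∃ c₀ : ℝ, 0 < c₀ ∧ ∀ (creg β : ℝ), 0 ≤ creg → 0 < β →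
      ∃ e₁ : ℝ, 0 < e₁ ∧ ∀ (k : ℕ), 1 ≤ k → ∀ (hn : 1 ≤ (ℓ + 1) ^ k) (a m2 : ℝ),
      amin ≤ a → a ≤ aplus → 0 ≤ m2 → m2 ≤ m2plus →
      ∀ (Ωc : Finset (Fin (d + 1) → ℤ)), IsBlockUnion K Ωc →
      ∀ (Ac : (Fin (d + 1) → ℤ) → Fin (d + 1) → ℝ) (e : ℝ), 0 < e → e ≤ e₁ →
        (∀ x ∈ fineDom ((ℓ + 1) ^ k) Ωc, ∀ μ ν : Fin (d + 1),
          |Ac (x + e1 μ) ν - Ac x ν| ≤ creg * e ^ (β - 1) / ((ℓ + 1) ^ k : ℕ)) →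
      ∀ (μ : Fin (d + 1)) (x x' : ↥(fineDom ((ℓ + 1) ^ k) Ωc)), x.1 + e1 μ ∈ fineDom ((ℓ + 1) ^ k) Ωc →
        x'.1 + e1 μ ∈ fineDom ((ℓ + 1) ^ k) Ωc → x'.1 ≠ x.1 →
      ∀ (l : List ↥(fineDom ((ℓ + 1) ^ k) Ωc)), IsNNChain x l → pathEnd x l = x' →
        (l.length : ℝ) ≤ ((d : ℝ) + 1) * supNorm (x'.1 - x.1) →
        (∀ z ∈ l, supNorm (z.1 - x.1) ≤ supNorm (x'.1 - x.1)) →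
        (∀ y : Fin (d + 1) → ℤ, (∀ ν, |y ν - blk ((ℓ + 1) ^ k) x.1 ν| ≤ (K : ℤ) * (d + 4)) → y ∈ Ωc) →
        (∀ y : Fin (d + 1) → ℤ, (∀ ν, |y ν - blk ((ℓ + 1) ^ k) x'.1 ν| ≤ (K : ℤ) * (d + 4)) → y ∈ Ωc) →
      ∀ (P : ↥(fineDom ((ℓ + 1) ^ k) Ωc) → Prop) (D : ℝ),
        (∀ x'', P x'' → ∃ ν, D ≤ |rpos ((ℓ + 1) ^ k) Ωc x ν - rpos ((ℓ + 1) ^ k) Ωc x'' ν|) →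
        (∀ x'', P x'' → ∃ ν, D ≤ |rpos ((ℓ + 1) ^ k) Ωc x' ν - rpos ((ℓ + 1) ^ k) Ωc x'' ν|) →
      ∀ (f : ↥(fineDom ((ℓ + 1) ^ k) Ωc) × ι → ℝ), (∀ p, ¬ P p.1 → f p = 0) →
      ∀ i : ι,
        ((((ℓ + 1) ^ k : ℕ) : ℝ) / supNorm (x'.1 - x.1)) ^ α *
          |(transport (fieldLink F (e / ((ℓ + 1) ^ k : ℕ)) (acBond Ωc Ac)) x l
              *ᵥ fld (regionDeriv F e ((ℓ + 1) ^ k) Ωc Ac μ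
                    *ᵥ ((regionOp F e hn (B1.aSeq a ((ℓ : ℝ) + 1) k) m2 Ωc Ac)⁻¹ *ᵥ f)) x'
            - fld (regionDeriv F e ((ℓ + 1) ^ k) Ωc Ac μ
                    *ᵥ ((regionOp F e hn (B1.aSeq a ((ℓ : ℝ) + 1) k) m2 Ωc Ac)⁻¹ *ᵥ f)) x) i|
          ≤ c₀ * Real.exp (-(D / (2 * ((((ℓ + 1) ^ k : ℕ) : ℝ) * K)))) * ‖f‖ := by
  classical
  obtain ⟨K, hK16, h8, HU⟩ := thm19_holder_region_all_unifK F hℓ₁ hLip d ℓ hℓ amin aplus m2plus ha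
  have hK0 : (0 : ℝ) < K := by exact_mod_cast (show 0 < K by omega)
  set V : ℝ := max (Real.sqrt (Fintype.card ι)) 1 with hV
  have hV1 : (1 : ℝ) ≤ V := le_max_right _ _
  refine ⟨K, hK16, h8, fun α hα0 hα1 => ?_⟩
  obtain ⟨c₀, hc₀, H⟩ := HU α hα0 hα1
  refine ⟨c₀ * V * (2 * Real.exp (2 / K) * max (latticeConst (d + 1) (1 / (2 * K))) 1), by positivity,
    fun creg β hcreg hβ => ?_⟩
  obtain ⟨e₁, he₁, H'⟩ := H creg β hcreg hβ
  refine ⟨e₁, he₁, ?_⟩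
  intro k hk hn a m2 ha1 ha2 hm1 hm2 Ωc hΩ Ac e he hle h17 μ x x' hxμ hx'μ hne l hl hlend hlen hlnear hxR hx'R P D
    hD₁ hD₂ f hf i
  -- the Hölder probe as an additive functional of `f`
  set T := transport (fieldLink F (e / ((ℓ + 1) ^ k : ℕ)) (acBond Ωc Ac)) x l with hT
  set N := regionDeriv F e ((ℓ + 1) ^ k) Ωc Ac μ * (regionOp F e hn (B1.aSeq a ((ℓ : ℝ) + 1) k) m2 Ωc Ac)⁻¹
    with hN
  set w : ℝ := ((((ℓ + 1) ^ k : ℕ) : ℝ) / supNorm (x'.1 - x.1)) ^ α with hw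
  have hw0 : 0 ≤ w := Real.rpow_nonneg (div_nonneg (Nat.cast_nonneg _) (supNorm_nonneg _)) α
  set φ : (↥(fineDom ((ℓ + 1) ^ k) Ωc) × ι → ℝ) → ℝ :=
    fun g => w * ((T *ᵥ fld (N *ᵥ g) x' - fld (N *ᵥ g) x) i) with hφ
  have hφabs : ∀ g, |φ g| = w * |(T *ᵥ fld (N *ᵥ g) x' - fld (N *ᵥ g) x) i| := by
    intro g; rw [hφ]; exact (abs_mul _ _).trans (by rw [abs_of_nonneg hw0])
  have hNg : ∀ g : ↥(fineDom ((ℓ + 1) ^ k) Ωc) × ι → ℝ, N *ᵥ g = regionDeriv F e ((ℓ + 1) ^ k) Ωc Ac μ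
      *ᵥ ((regionOp F e hn (B1.aSeq a ((ℓ : ℝ) + 1) k) m2 Ωc Ac)⁻¹ *ᵥ g) := by
    intro g; rw [hN, ← Matrix.mulVec_mulVec]
  have key := cubeSum_bound₂ hn hK0 (c₀ := c₀ * V) (by positivity) φ
    (fun s g => by simp only [hφ]; exact holder_expr_sum w T N x x' i s g) x x' P
    (fun y₀ D' hD0' hD1' hD2' g hg _ => by
      rw [hφabs, hNg]
      have hgV : lpv (vol d ℓ k)⁻¹ 2 g ≤ V * ‖g‖ :=
        (lpv_two_le_unitBlock hn y₀ g hg).trans (mul_le_mul_of_nonneg_right (le_max_left _ _) (norm_nonneg g))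
      have h := H' k hk hn a m2 ha1 ha2 hm1 hm2 Ωc hΩ Ac e he hle h17 μ x x' hxμ hx'μ hne l hl hlend hlen hlnear hxR hx'R
        (fun x'' => blk ((ℓ + 1) ^ k) x''.1 = y₀) D' hD0' hD1' hD2' g (fun p hp => hg p hp) V hV1 hgV i
      calc w * |(T *ᵥ fld (regionDeriv F e ((ℓ + 1) ^ k) Ωc Ac μ *ᵥ
              ((regionOp F e hn (B1.aSeq a ((ℓ : ℝ) + 1) k) m2 Ωc Ac)⁻¹ *ᵥ g)) x' -
              fld (regionDeriv F e ((ℓ + 1) ^ k) Ωc Ac μ *ᵥ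
              ((regionOp F e hn (B1.aSeq a ((ℓ : ℝ) + 1) k) m2 Ωc Ac)⁻¹ *ᵥ g)) x) i|
          ≤ c₀ * V * Real.exp (-(D' / ((((ℓ + 1) ^ k : ℕ) : ℝ) * K))) * ‖g‖ := h
        _ = c₀ * V * Real.exp (-(D' / ((((ℓ + 1) ^ k : ℕ) : ℝ) * K))) * ‖g‖ := rfl)
    D hD₁ hD₂ f hf
  rw [hφabs, hNg] at key
  calc _ ≤ c₀ * V * (2 * Real.exp (2 / K) * max (latticeConst (d + 1) (1 / (2 * K))) 1) *
        Real.exp (-(D / (2 * ((((ℓ + 1) ^ k : ℕ) : ℝ) * K)))) * ‖f‖ := key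
    _ = _ := by ring

end Main

end

end Literature.MathematicalPhysics.QuantumFieldTheory.Balaban1983to89.B4Thm19RegionUnifK
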